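import Summits.QuantumFields.BalabanUV.Beta.CapRouteAFins
import Summits.QuantumFields.BalabanUV.Beta.CoverSchedules

/-!
# Beta / CapRouteASchedules — ROUTE A'S ANCHOR OVER KERNEL SCHEDULES: the typed target of row CAP-k with NO coverage hypothesis
# (β sub-cell, BINDER-OWNERS row CAP-k, lineage `b2b-balaban-beta-an5`, gen 26; node BETA-an5-g26-SCHEDULES, leaf 2; journal CLAIM l.17735)

`CoverSchedules` (leaf 1): box schedules `Sched d` (a leaf, or a uniform split with one sub-schedule per cell), their leaf lists, and the two
coverage binders of the typed target as theorems — `hcov_of_schedules` (quarter region of the vertex tori), `hcovF_of_schedules` (fin rectangle).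
THIS LEAF re-issues the row's typed target over schedule DATA:

* **`rowsOfOneLoopFormCode16E_routeA₂_ofSchedules`** = `CapRouteAFins.rowsOfOneLoopFormCode16E_routeA₂_ofBoxesRealShift_ofReflect_ofFinRects` with
  `boxes ∕ ctr ∕ hw ∕ hcov` REPLACED by a family of box schedules `S : (Fin 4 → Bool) → Sched 3` (one per sign class `s` with `s ν₀ = true`, run on
  the root box `Re q_{ν₁} ∈ [−π, 0]`, `Re q_μ ∈ [−π, π]` otherwise) and `rects ∕ τc ∕ xc ∕ hτ ∕ hx ∕ hcovF` REPLACED by four fin schedules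
  `F : Fin 4 → Sched 1` (run on `[0, 1] × [−π, π]`) — and NO coverage hypothesis: the per-leaf certificates `hcert` ∕ `hcertF` are indexed by the
  KERNEL's leaf lists `quarterBoxes κ ν₀ ν₁ S` ∕ `finRects (F i)`; `_eq` (it IS the `_ofFinRects` anchor at the schedule data, `rfl`); `_k₀ = 0`;
* `hcert_of_signClasses` — the per-leaf binder in the engines' natural indexing (sign class `s`, real leaf `bx` of `S s`, complex box
  `cbox (signVec κ s) bx`) ⟹ the anchor's `hcert`;
* `rowsOfOneLoopFormCode16E_routeA₂_ofSchedules'` — the same anchor taking `hcert` in that indexing.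

THE ROW'S BINDER LIST AFTER THIS NODE (census v1.7 V29): (N) `hb` ∣ STRUCTURE `MatTubeHol` ×5, `MatNegTranspose A`, `MatConjSymm A`, `hR` ∣
schedule DATA `S`, `F` (no hypothesis) ∣ per box leaf of `S`: `IsUnit (A q).det ∧ ‖(A q)⁻¹‖ ≤ Ba` ∣ per fin leaf of `F`: `IsUnit (A p).det` ∣
(Z2b) `hSst hSs hSt` ∣ (T) `hT` ∣ (A) `hA₀` ∣ cmp `hlo`.  The engines' job list IS the kernel's leaf list; no coverage fact and no box-list
bookkeeping is left outside the kernel.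

HONEST FRAMING.  Kernel glue: ONE constructor application over leaf 1 + the gen-25 anchor; no schedule for the cell's `k₀`, no box, no number
supplied; 0 binders instantiated; 0 certified coefficients; no box ∕ fin certificate exists.  Discharging `BetaPertH` would make Bałaban's
ultraviolet stability unconditional — NOT the continuum limit, NOT the Clay problem.  0 `sorry`, 0 cite tags.
-/

namespace Summit.QuantumFields.BalabanUV.Beta.CapRouteASchedules

open Complex Set Matrix
open Literature.MathematicalPhysics.QuantumFieldTheory.Balaban1983to89
open B4Strip (Strip)
open B4ContourShift (latticeKernel)
open B4TorusKernel (descend gridPt)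
open Beta.AliasingTailL1 (aliasRatioL1)
open Beta.AliasingTailLattice (codeTheta code16SetE)
open Summit.QuantumFields.BalabanUV.Beta.CapRows (Rows)
open Summit.QuantumFields.BalabanUV.Beta.TubeMaximumModulus
open Summit.QuantumFields.BalabanUV.Beta.VertexToriSymmetry
open Summit.QuantumFields.BalabanUV.Beta.ConjReflectionAlgebra (MatConjSymm)
open Summit.QuantumFields.BalabanUV.Beta.ResolventBoxCertificate (Box)
open Summit.QuantumFields.BalabanUV.Beta.CoverSchedules
open Summit.QuantumFields.BalabanUV.Beta.CapRouteAFins (rowsOfOneLoopFormCode16E_routeA₂_ofBoxesRealShift_ofReflect_ofFinRects)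
open scoped Real Matrix.Norms.L2Operator

noncomputable section

/-! ## §1 The per-leaf binder in the engines' indexing -/

section Indexing

variable {d : ℕ} {w : Fin (d + 1) → ℝ} {ν₀ ν₁ : Fin (d + 1)} {S : (Fin (d + 1) → Bool) → Sched d}

/-- **PER SIGN CLASS, PER REAL LEAF ⟹ PER BOX OF THE LIST**: a property certified on the complex box over every real leaf of every sign-class
schedule holds on every box of `quarterBoxes w ν₀ ν₁ S` (the engines' natural loop order: for `s` with `s ν₀ = true`, for `bx ∈ (S s).leaves root`,
certify `Box (cbox (signVec w s) bx)`). [folklore] -/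
theorem hcert_of_signClasses {P : (Fin (d + 1) → ℂ) → Prop}
    (h : ∀ s : Fin (d + 1) → Bool, s ν₀ = true →
      ∀ bx ∈ (S s).leaves (quarterRootCtr ν₁) (quarterRootHw ν₁),
        ∀ q ∈ Box (cbox (signVec w s) bx).1 (cbox (signVec w s) bx).2, P q) :
    ∀ bxc ∈ quarterBoxes w ν₀ ν₁ S, ∀ q ∈ Box bxc.1 bxc.2, P q := by
  intro bxc hbxc q hq
  obtain ⟨s, hs0, bx, hbx, rfl⟩ := mem_quarterBoxes.mp hbxc
  exact h s hs0 bx hbx q hq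

/-- conversely, the list form gives the sign-class form. [folklore] -/
theorem signClasses_of_hcert {P : (Fin (d + 1) → ℂ) → Prop}
    (h : ∀ bxc ∈ quarterBoxes w ν₀ ν₁ S, ∀ q ∈ Box bxc.1 bxc.2, P q) :
    ∀ s : Fin (d + 1) → Bool, s ν₀ = true →
      ∀ bx ∈ (S s).leaves (quarterRootCtr ν₁) (quarterRootHw ν₁),
        ∀ q ∈ Box (cbox (signVec w s) bx).1 (cbox (signVec w s) bx).2, P q :=
  fun s hs0 bx hbx q hq => h _ (mem_quarterBoxes.mpr ⟨s, hs0, bx, hbx, rfl⟩) q hq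

end Indexing

/-! ## §2 The anchor over schedules -/

section Anchor

variable {n : Type*} [Fintype n] [DecidableEq n]
variable {b : ℕ → ℝ} {A B C D : (Fin 4 → ℂ) → Matrix n n ℂ} {κ Ba Sst Ss St : ℝ} {c : Fin 4 → ℂ}

/-- **ROUTE A'S ANCHOR OVER KERNEL SCHEDULES (row CAP-k's typed target, NO coverage hypothesis).**  Exactly
`CapRouteAFins.rowsOfOneLoopFormCode16E_routeA₂_ofBoxesRealShift_ofReflect_ofFinRects` (data: (N) `hb`; STRUCTURE `MatTubeHol` ×5 at width `κ`,
`MatNegTranspose A`, `MatConjSymm A`, `hR`; (Z2b) stencil sups; (T) `hT`; (A) `hA₀`; cmp `hlo`) with the box list := `quarterBoxes κ ν₀ ν₁ S` of a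
family of SCHEDULES `S` (coverage = `CoverSchedules.hcov_of_schedules`, a theorem) and the fin rectangles := `finRects (F i)` of four fin SCHEDULES
`F` (coverage = `CoverSchedules.hcovF_of_schedules`, a theorem); the per-leaf certificates `hcert` ∕ `hcertF` are indexed by those kernel leaf
lists. [folklore] -/
def rowsOfOneLoopFormCode16E_routeA₂_ofSchedules
    (hb : b 0 = (latticeKernel (fun p => ((A p)⁻¹ * B p).trace - ((A p)⁻¹ * C p * (A (p - c))⁻¹ * D p).trace) 0).re)
    (hκ : 0 < κ) (hc : ∀ μ, (c μ).im = 0)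
    (hA : MatTubeHol A (fun _ => κ)) (hA' : MatTubeHol (fun p => A (p - c)) (fun _ => κ))
    (hBst : MatTubeHol B (fun _ => κ)) (hBs : MatTubeHol C (fun _ => κ)) (hBt : MatTubeHol D (fun _ => κ))
    (hAn : MatNegTranspose A) (hAc : MatConjSymm A)
    (ν₀ ν₁ : Fin (3 + 1)) (S : (Fin (3 + 1) → Bool) → Sched 3)
    (hcert : ∀ bx ∈ quarterBoxes (fun _ : Fin (3 + 1) => κ) ν₀ ν₁ S, ∀ q ∈ Box bx.1 bx.2, IsUnit (A q).det ∧ ‖(A q)⁻¹‖ ≤ Ba)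
    (hR : ∀ (ν : Fin (3 + 1)) (p : Fin (3 + 1) → ℂ), (A (reflectAt ν p)).det = (A p).det)
    (F : Fin (3 + 1) → Sched 1)
    (hcertF : ∀ (i : Fin (3 + 1)), ∀ bx ∈ finRects (F i), ∀ τ x : ℝ, |τ - bx.1 0| ≤ bx.2 0 → |x - bx.1 1| ≤ bx.2 1 →
      IsUnit (A (i.insertNth ((x : ℂ) + ((τ * κ : ℝ) : ℂ) * I) fun _ => ((τ * κ : ℝ) : ℂ) * I)).det)
    (hSst : ∀ p ∈ VertexTori (fun _ : Fin (3 + 1) => κ), ‖B p‖ ≤ Sst)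
    (hSs : ∀ p ∈ VertexTori (fun _ : Fin (3 + 1) => κ), ‖C p‖ ≤ Ss)
    (hSt : ∀ p ∈ VertexTori (fun _ : Fin (3 + 1) => κ), ‖D p‖ ≤ St)
    {N : ℕ} (hN : 1 ≤ N) [NeZero (4 * N)] {t r : ℝ}
    (hT : ‖((code16SetE N).card : ℂ)⁻¹ *
        (∑ w ∈ code16SetE N, descend (fun p => ((A p)⁻¹ * B p).trace - ((A p)⁻¹ * C p * (A (p - c))⁻¹ * D p).trace)
          (gridPt (4 * N) w)) - t‖ ≤ r)
    {A₀ : ℝ} (hA₀ : Fintype.card n * (Ba * Sst + Ba * Ss * Ba * St) * codeTheta (aliasRatioL1 κ N) ≤ A₀) (lo : ℚ)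
    (hlo : ((lo : ℚ) : ℝ) ≤ t - r - A₀) : Rows b :=
  rowsOfOneLoopFormCode16E_routeA₂_ofBoxesRealShift_ofReflect_ofFinRects hb hκ hc hA hA' hBst hBs hBt hAn hAc ν₀ ν₁
    (quarterBoxes (fun _ : Fin (3 + 1) => κ) ν₀ ν₁ S) Prod.fst Prod.snd (hcov_of_schedules _ ν₀ ν₁ S) hcert hR
    (fun i => finRects (F i)) (fun _ bx => bx.1 0) (fun _ bx => bx.1 1) (fun _ bx => bx.2 0) (fun _ bx => bx.2 1)
    (hcovF_of_schedules F) hcertF hSst hSs hSt hN hT hA₀ lo hlo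

/-- it IS the `_ofFinRects` anchor at the schedule data (definitional bookkeeping, for the cross-reader). [folklore] -/
theorem rowsOfOneLoopFormCode16E_routeA₂_ofSchedules_eq
    (hb : b 0 = (latticeKernel (fun p => ((A p)⁻¹ * B p).trace - ((A p)⁻¹ * C p * (A (p - c))⁻¹ * D p).trace) 0).re)
    (hκ : 0 < κ) (hc : ∀ μ, (c μ).im = 0)
    (hA : MatTubeHol A (fun _ => κ)) (hA' : MatTubeHol (fun p => A (p - c)) (fun _ => κ))
    (hBst : MatTubeHol B (fun _ => κ)) (hBs : MatTubeHol C (fun _ => κ)) (hBt : MatTubeHol D (fun _ => κ))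
    (hAn : MatNegTranspose A) (hAc : MatConjSymm A)
    (ν₀ ν₁ : Fin (3 + 1)) (S : (Fin (3 + 1) → Bool) → Sched 3)
    (hcert : ∀ bx ∈ quarterBoxes (fun _ : Fin (3 + 1) => κ) ν₀ ν₁ S, ∀ q ∈ Box bx.1 bx.2, IsUnit (A q).det ∧ ‖(A q)⁻¹‖ ≤ Ba)
    (hR : ∀ (ν : Fin (3 + 1)) (p : Fin (3 + 1) → ℂ), (A (reflectAt ν p)).det = (A p).det)
    (F : Fin (3 + 1) → Sched 1)
    (hcertF : ∀ (i : Fin (3 + 1)), ∀ bx ∈ finRects (F i), ∀ τ x : ℝ, |τ - bx.1 0| ≤ bx.2 0 → |x - bx.1 1| ≤ bx.2 1 →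
      IsUnit (A (i.insertNth ((x : ℂ) + ((τ * κ : ℝ) : ℂ) * I) fun _ => ((τ * κ : ℝ) : ℂ) * I)).det)
    (hSst : ∀ p ∈ VertexTori (fun _ : Fin (3 + 1) => κ), ‖B p‖ ≤ Sst)
    (hSs : ∀ p ∈ VertexTori (fun _ : Fin (3 + 1) => κ), ‖C p‖ ≤ Ss)
    (hSt : ∀ p ∈ VertexTori (fun _ : Fin (3 + 1) => κ), ‖D p‖ ≤ St)
    {N : ℕ} (hN : 1 ≤ N) [NeZero (4 * N)] {t r : ℝ}
    (hT : ‖((code16SetE N).card : ℂ)⁻¹ *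
        (∑ w ∈ code16SetE N, descend (fun p => ((A p)⁻¹ * B p).trace - ((A p)⁻¹ * C p * (A (p - c))⁻¹ * D p).trace)
          (gridPt (4 * N) w)) - t‖ ≤ r)
    {A₀ : ℝ} (hA₀ : Fintype.card n * (Ba * Sst + Ba * Ss * Ba * St) * codeTheta (aliasRatioL1 κ N) ≤ A₀) (lo : ℚ)
    (hlo : ((lo : ℚ) : ℝ) ≤ t - r - A₀) :
    rowsOfOneLoopFormCode16E_routeA₂_ofSchedules hb hκ hc hA hA' hBst hBs hBt hAn hAc ν₀ ν₁ S hcert hR F hcertF hSst hSs hSt hN hT hA₀ lo hlo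
      = rowsOfOneLoopFormCode16E_routeA₂_ofBoxesRealShift_ofReflect_ofFinRects hb hκ hc hA hA' hBst hBs hBt hAn hAc ν₀ ν₁
          (quarterBoxes (fun _ : Fin (3 + 1) => κ) ν₀ ν₁ S) Prod.fst Prod.snd (hcov_of_schedules _ ν₀ ν₁ S) hcert hR
          (fun i => finRects (F i)) (fun _ bx => bx.1 0) (fun _ bx => bx.1 1) (fun _ bx => bx.2 0) (fun _ bx => bx.2 1)
          (hcovF_of_schedules F) hcertF hSst hSs hSt hN hT hA₀ lo hlo := rfl

/-- its level is `k₀ = 0`. [folklore] -/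
theorem rowsOfOneLoopFormCode16E_routeA₂_ofSchedules_k₀
    (hb : b 0 = (latticeKernel (fun p => ((A p)⁻¹ * B p).trace - ((A p)⁻¹ * C p * (A (p - c))⁻¹ * D p).trace) 0).re)
    (hκ : 0 < κ) (hc : ∀ μ, (c μ).im = 0)
    (hA : MatTubeHol A (fun _ => κ)) (hA' : MatTubeHol (fun p => A (p - c)) (fun _ => κ))
    (hBst : MatTubeHol B (fun _ => κ)) (hBs : MatTubeHol C (fun _ => κ)) (hBt : MatTubeHol D (fun _ => κ))
    (hAn : MatNegTranspose A) (hAc : MatConjSymm A)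
    (ν₀ ν₁ : Fin (3 + 1)) (S : (Fin (3 + 1) → Bool) → Sched 3)
    (hcert : ∀ bx ∈ quarterBoxes (fun _ : Fin (3 + 1) => κ) ν₀ ν₁ S, ∀ q ∈ Box bx.1 bx.2, IsUnit (A q).det ∧ ‖(A q)⁻¹‖ ≤ Ba)
    (hR : ∀ (ν : Fin (3 + 1)) (p : Fin (3 + 1) → ℂ), (A (reflectAt ν p)).det = (A p).det)
    (F : Fin (3 + 1) → Sched 1)
    (hcertF : ∀ (i : Fin (3 + 1)), ∀ bx ∈ finRects (F i), ∀ τ x : ℝ, |τ - bx.1 0| ≤ bx.2 0 → |x - bx.1 1| ≤ bx.2 1 →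
      IsUnit (A (i.insertNth ((x : ℂ) + ((τ * κ : ℝ) : ℂ) * I) fun _ => ((τ * κ : ℝ) : ℂ) * I)).det)
    (hSst : ∀ p ∈ VertexTori (fun _ : Fin (3 + 1) => κ), ‖B p‖ ≤ Sst)
    (hSs : ∀ p ∈ VertexTori (fun _ : Fin (3 + 1) => κ), ‖C p‖ ≤ Ss)
    (hSt : ∀ p ∈ VertexTori (fun _ : Fin (3 + 1) => κ), ‖D p‖ ≤ St)
    {N : ℕ} (hN : 1 ≤ N) [NeZero (4 * N)] {t r : ℝ}
    (hT : ‖((code16SetE N).card : ℂ)⁻¹ *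
        (∑ w ∈ code16SetE N, descend (fun p => ((A p)⁻¹ * B p).trace - ((A p)⁻¹ * C p * (A (p - c))⁻¹ * D p).trace)
          (gridPt (4 * N) w)) - t‖ ≤ r)
    {A₀ : ℝ} (hA₀ : Fintype.card n * (Ba * Sst + Ba * Ss * Ba * St) * codeTheta (aliasRatioL1 κ N) ≤ A₀) (lo : ℚ)
    (hlo : ((lo : ℚ) : ℝ) ≤ t - r - A₀) :
    (rowsOfOneLoopFormCode16E_routeA₂_ofSchedules hb hκ hc hA hA' hBst hBs hBt hAn hAc ν₀ ν₁ S hcert hR F hcertF hSst hSs hSt hN hT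
      hA₀ lo hlo).k₀ = 0 := rfl

/-- **THE SAME ANCHOR WITH `hcert` IN THE ENGINES' INDEXING** (sign class `s` with `s ν₀ = true`, real leaf `bx` of `S s` on the root box, complex
box `cbox (signVec κ s) bx`) — via `hcert_of_signClasses`. [folklore] -/
def rowsOfOneLoopFormCode16E_routeA₂_ofSchedules'
    (hb : b 0 = (latticeKernel (fun p => ((A p)⁻¹ * B p).trace - ((A p)⁻¹ * C p * (A (p - c))⁻¹ * D p).trace) 0).re)
    (hκ : 0 < κ) (hc : ∀ μ, (c μ).im = 0)
    (hA : MatTubeHol A (fun _ => κ)) (hA' : MatTubeHol (fun p => A (p - c)) (fun _ => κ))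
    (hBst : MatTubeHol B (fun _ => κ)) (hBs : MatTubeHol C (fun _ => κ)) (hBt : MatTubeHol D (fun _ => κ))
    (hAn : MatNegTranspose A) (hAc : MatConjSymm A)
    (ν₀ ν₁ : Fin (3 + 1)) (S : (Fin (3 + 1) → Bool) → Sched 3)
    (hcert : ∀ s : Fin (3 + 1) → Bool, s ν₀ = true →
      ∀ bx ∈ (S s).leaves (quarterRootCtr ν₁) (quarterRootHw ν₁),
        ∀ q ∈ Box (cbox (signVec (fun _ : Fin (3 + 1) => κ) s) bx).1 (cbox (signVec (fun _ : Fin (3 + 1) => κ) s) bx).2,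
          IsUnit (A q).det ∧ ‖(A q)⁻¹‖ ≤ Ba)
    (hR : ∀ (ν : Fin (3 + 1)) (p : Fin (3 + 1) → ℂ), (A (reflectAt ν p)).det = (A p).det)
    (F : Fin (3 + 1) → Sched 1)
    (hcertF : ∀ (i : Fin (3 + 1)), ∀ bx ∈ finRects (F i), ∀ τ x : ℝ, |τ - bx.1 0| ≤ bx.2 0 → |x - bx.1 1| ≤ bx.2 1 →
      IsUnit (A (i.insertNth ((x : ℂ) + ((τ * κ : ℝ) : ℂ) * I) fun _ => ((τ * κ : ℝ) : ℂ) * I)).det)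
    (hSst : ∀ p ∈ VertexTori (fun _ : Fin (3 + 1) => κ), ‖B p‖ ≤ Sst)
    (hSs : ∀ p ∈ VertexTori (fun _ : Fin (3 + 1) => κ), ‖C p‖ ≤ Ss)
    (hSt : ∀ p ∈ VertexTori (fun _ : Fin (3 + 1) => κ), ‖D p‖ ≤ St)
    {N : ℕ} (hN : 1 ≤ N) [NeZero (4 * N)] {t r : ℝ}
    (hT : ‖((code16SetE N).card : ℂ)⁻¹ *
        (∑ w ∈ code16SetE N, descend (fun p => ((A p)⁻¹ * B p).trace - ((A p)⁻¹ * C p * (A (p - c))⁻¹ * D p).trace)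
          (gridPt (4 * N) w)) - t‖ ≤ r)
    {A₀ : ℝ} (hA₀ : Fintype.card n * (Ba * Sst + Ba * Ss * Ba * St) * codeTheta (aliasRatioL1 κ N) ≤ A₀) (lo : ℚ)
    (hlo : ((lo : ℚ) : ℝ) ≤ t - r - A₀) : Rows b :=
  rowsOfOneLoopFormCode16E_routeA₂_ofSchedules hb hκ hc hA hA' hBst hBs hBt hAn hAc ν₀ ν₁ S (hcert_of_signClasses hcert) hR F hcertF
    hSst hSs hSt hN hT hA₀ lo hlo

/-- its level is `k₀ = 0`. [folklore] -/
theorem rowsOfOneLoopFormCode16E_routeA₂_ofSchedules'_k₀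
    (hb : b 0 = (latticeKernel (fun p => ((A p)⁻¹ * B p).trace - ((A p)⁻¹ * C p * (A (p - c))⁻¹ * D p).trace) 0).re)
    (hκ : 0 < κ) (hc : ∀ μ, (c μ).im = 0)
    (hA : MatTubeHol A (fun _ => κ)) (hA' : MatTubeHol (fun p => A (p - c)) (fun _ => κ))
    (hBst : MatTubeHol B (fun _ => κ)) (hBs : MatTubeHol C (fun _ => κ)) (hBt : MatTubeHol D (fun _ => κ))
    (hAn : MatNegTranspose A) (hAc : MatConjSymm A)
    (ν₀ ν₁ : Fin (3 + 1)) (S : (Fin (3 + 1) → Bool) → Sched 3)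
    (hcert : ∀ s : Fin (3 + 1) → Bool, s ν₀ = true →
      ∀ bx ∈ (S s).leaves (quarterRootCtr ν₁) (quarterRootHw ν₁),
        ∀ q ∈ Box (cbox (signVec (fun _ : Fin (3 + 1) => κ) s) bx).1 (cbox (signVec (fun _ : Fin (3 + 1) => κ) s) bx).2,
          IsUnit (A q).det ∧ ‖(A q)⁻¹‖ ≤ Ba)
    (hR : ∀ (ν : Fin (3 + 1)) (p : Fin (3 + 1) → ℂ), (A (reflectAt ν p)).det = (A p).det)
    (F : Fin (3 + 1) → Sched 1)
    (hcertF : ∀ (i : Fin (3 + 1)), ∀ bx ∈ finRects (F i), ∀ τ x : ℝ, |τ - bx.1 0| ≤ bx.2 0 → |x - bx.1 1| ≤ bx.2 1 →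
      IsUnit (A (i.insertNth ((x : ℂ) + ((τ * κ : ℝ) : ℂ) * I) fun _ => ((τ * κ : ℝ) : ℂ) * I)).det)
    (hSst : ∀ p ∈ VertexTori (fun _ : Fin (3 + 1) => κ), ‖B p‖ ≤ Sst)
    (hSs : ∀ p ∈ VertexTori (fun _ : Fin (3 + 1) => κ), ‖C p‖ ≤ Ss)
    (hSt : ∀ p ∈ VertexTori (fun _ : Fin (3 + 1) => κ), ‖D p‖ ≤ St)
    {N : ℕ} (hN : 1 ≤ N) [NeZero (4 * N)] {t r : ℝ}
    (hT : ‖((code16SetE N).card : ℂ)⁻¹ *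
        (∑ w ∈ code16SetE N, descend (fun p => ((A p)⁻¹ * B p).trace - ((A p)⁻¹ * C p * (A (p - c))⁻¹ * D p).trace)
          (gridPt (4 * N) w)) - t‖ ≤ r)
    {A₀ : ℝ} (hA₀ : Fintype.card n * (Ba * Sst + Ba * Ss * Ba * St) * codeTheta (aliasRatioL1 κ N) ≤ A₀) (lo : ℚ)
    (hlo : ((lo : ℚ) : ℝ) ≤ t - r - A₀) :
    (rowsOfOneLoopFormCode16E_routeA₂_ofSchedules' hb hκ hc hA hA' hBst hBs hBt hAn hAc ν₀ ν₁ S hcert hR F hcertF hSst hSs hSt hN hT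
      hA₀ lo hlo).k₀ = 0 := rfl

end Anchor

end

end Summit.QuantumFields.BalabanUV.Beta.CapRouteASchedules
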